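import Literature.NumberTheory.EllipticCurves.IsogenyQuotientCurveProofs
import Literature.NumberTheory.EllipticCurves.IsogenySeparableFactorProofs
import Literature.NumberTheory.EllipticCurves.IsogenyXRationalFunctionProofs
import Literature.NumberTheory.EllipticCurves.IsogenyCompProofs
import Literature.NumberTheory.EllipticCurves.IsogenyVariableChangeProofs
import Literature.NumberTheory.EllipticCurves.GlobalMinimalModelProofs
import Mathlib.GroupTheory.PGroup
import HarnessLib

/-!
# Stub `stub_isogenyFactor` of line `nsf` (v2) on the crux `StarOptBNSF` (item stmt-BirchSwinnertonDyer-27047) — PROVED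

Line `nsf` v2 (planner bsd-rank2-p2 GEN 32, skeleton `Cruxes/StarOptBNSF/Lines/nsf.lean`, registered
2026-08-28T11:06Z on stmt-BirchSwinnertonDyer-27047): `StarOptBNSF ⇐ stub_thmAShadow ∧ stub_isogenyFactor ∧
stub_oddIsogenyInvariance ∧ stub_twoPowerWalk` (composition `StarOptBNSF_of`, kernel-checked by the planner; the
split of v1's `stub_regimeTransport` is the PROVED `regimeTransport_of`).  THIS FILE closes the registered stub

  `stub_isogenyFactor : ∀ W W₀ [ell], IsIsogenous W W₀ → ∃ V (ell) (globally minimal) (φ₁ : Isogeny W V)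
     (ψ : Isogeny W₀ V), (∃ k, φ₁.degree = 2 ^ k) ∧ Odd ψ.degree`

— the 2-POWER / ODD FACTORISATION OF A ℚ-ISOGENY THROUGH A GLOBAL MINIMAL MODEL.  Proof (Silverman, *AEC*
III.4.12, III.4.11, III.6.1, VIII.8.3, all TREE THEOREMS): let `φ : W → W₀`, `K = ker φ` (finite, `Γ_ℚ`-stable) and
`S = {P ∈ K : 2^n P = O for some n}` its 2-primary part (a finite `Γ_ℚ`-stable subgroup, a 2-group, so `#S = 2^k`,
Mathlib `IsPGroup.iff_card`).  The quotient `g : W → W' = W/S` (`exists_isogeny_ker_eq_and_comp_eq_nsmul_holds`)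
has `ker g = S`, degree `2^k`; since `ker g ⊆ ker φ` and every isogeny is separable in characteristic `0`
(`Isogeny.degree_eq_deg`), `φ = λ ∘ g` for an isogeny `λ : W' → W₀` (`Isogeny.exists_eq_comp_of_ker_le`, AEC III.4.11),
and `#ker λ` is ODD: an element `Q = g P` of order `2` in `ker λ` (Cauchy) has `P ∈ K` and `2P ∈ S`, so `P ∈ S = ker g`
and `Q = O`.  The dual `λ̂ : W₀ → W'` (`Isogeny.exists_dual_of_deg_le_card_ker`, AEC III.6.1–6.2: `λ λ̂ = [#ker λ]`) has
odd degree too: an element `Q` of order `2` in `ker λ̂` satisfies `(#ker λ) • Q = λ (λ̂ Q) = O`, forcing `2 ∣ #ker λ`.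
Finally move `W'` to a global minimal model `V = C • W'` (`hasGlobalMinimalModel_rat_holds`, AEC VIII.8.3) by the
degree-one isogeny `VariableChange.toIsogeny W' C` and compose (`Isogeny.comp`; kernels unchanged).

HONEST FRAMING: stub 3a of line nsf (size M, kernel bookkeeping); the research stub `stub_thmAShadow` and the two
transport stubs `stub_oddIsogenyInvariance` / `stub_twoPowerWalk` are untouched.  Fact-free (standard axioms).
Nothing here proves `StarOptBNSF`, E1M_NSF or BSD.

References: J. H. Silverman, *The Arithmetic of Elliptic Curves*, 2nd ed., GTM 106 (2009), Prop. III.4.12,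
Cor. III.4.11, Thm. III.6.1–6.2, Cor. VIII.8.3 [SilvermanAEC2009].
-/

set_option linter.dupNamespace false
set_option autoImplicit false

noncomputable section

open scoped Classical

namespace Summit.BirchSwinnertonDyer.BirchSwinnertonDyer.Theorems.EisensteinDepletionAtTwoStarOptBNSFStubIsogenyFactor

open WeierstrassCurve Literature.NumberTheory.EllipticCurves

/-! ### §1 Group-theoretic bookkeeping: 2-primary parts and parity of kernel orders -/

/-- A finite additive group in which every element is killed by a power of `2` has order a power of `2`
(Mathlib's `IsPGroup.iff_card`, through `Multiplicative`). [folklore] -/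
theorem natCard_eq_two_pow_of_forall_nsmul_eq_zero {G : Type*} [AddCommGroup G] [Finite G]
    (h : ∀ g : G, ∃ n : ℕ, (2 ^ n) • g = 0) : ∃ k : ℕ, Nat.card G = 2 ^ k := by
  haveI : Fact (Nat.Prime 2) := ⟨Nat.prime_two⟩
  have hP : IsPGroup 2 (Multiplicative G) := by
    intro g
    obtain ⟨n, hn⟩ := h (Multiplicative.toAdd g)
    exact ⟨n, by rw [← ofAdd_toAdd g, ← ofAdd_nsmul, hn, ofAdd_zero]⟩
  obtain ⟨k, hk⟩ := IsPGroup.iff_card.mp hP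
  exact ⟨k, hk⟩

/-- If a finite additive group has no element of order `2`, its order is odd (Cauchy). [folklore] -/
theorem odd_natCard_of_forall_addOrderOf_ne_two {G : Type*} [AddCommGroup G] [Finite G]
    (h : ∀ g : G, addOrderOf g ≠ 2) : Odd (Nat.card G) := by
  haveI : Fact (Nat.Prime 2) := ⟨Nat.prime_two⟩
  rw [← Nat.not_even_iff_odd, even_iff_two_dvd]
  intro h2
  obtain ⟨g, hg⟩ := exists_prime_addOrderOf_dvd_card' (G := G) 2 h2
  exact h g hg

/-! ### §2 The factorisation -/

variable {W W₀ : WeierstrassCurve ℚ} [W.IsElliptic] [W₀.IsElliptic]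

/-- **2-power / odd factorisation of a ℚ-isogeny, quotient form.**  For an isogeny `φ : W → W₀` of elliptic curves
over `ℚ` there are an elliptic curve `W'` over `ℚ`, an isogeny `g : W → W'` of 2-power degree (the quotient by the
2-primary part of `ker φ`, Silverman AEC III.4.12) and an isogeny `ψ : W₀ → W'` of odd degree (the dual, AEC
III.6.1, of the odd-degree factor `W' → W₀` of `φ`, AEC III.4.11).
[cite: SilvermanAEC2009, Prop. III.4.12, Cor. III.4.11, Thm. III.6.1] -/
theorem exists_twoPower_odd_isogeny (φ : Isogeny W W₀) :
    ∃ (W' : WeierstrassCurve ℚ) (_ : W'.IsElliptic) (g : Isogeny W W') (ψ : Isogeny W₀ W'),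
      (∃ k : ℕ, g.degree = 2 ^ k) ∧ Odd ψ.degree := by
  -- the 2-primary part `S` of `ker φ`
  let S : AddSubgroup W.geomPoints :=
    { carrier := {P | φ P = 0 ∧ ∃ n : ℕ, (2 ^ n) • P = 0}
      add_mem' := by
        rintro P Q ⟨hP, m, hm⟩ ⟨hQ, n, hn⟩
        refine ⟨by rw [map_add, hP, hQ, add_zero], m + n, ?_⟩
        rw [smul_add, pow_add, mul_comm, mul_smul, hm, smul_zero, zero_add, mul_comm, mul_smul, hn, smul_zero]
      zero_mem' := ⟨map_zero φ, 0, smul_zero _⟩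
      neg_mem' := by
        rintro P ⟨hP, n, hn⟩
        exact ⟨by rw [map_neg, hP, neg_zero], n, by rw [smul_neg, hn, neg_zero]⟩ }
  have hSmem : ∀ P : W.geomPoints, P ∈ S ↔ φ P = 0 ∧ ∃ n : ℕ, (2 ^ n) • P = 0 := fun P ↦ Iff.rfl
  have hSfin : (S : Set W.geomPoints).Finite :=
    φ.finite_ker.subset fun P hP ↦ (AddMonoidHom.mem_ker).mpr ((hSmem P).mp hP).1
  have hSstab : ∀ (σ : Field.absoluteGaloisGroup ℚ) (P : W.geomPoints), P ∈ S → σ • P ∈ S := by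
    rintro σ P ⟨hP, n, hn⟩
    refine ⟨by rw [φ.map_smul, hP, smul_zero], n, ?_⟩
    rw [smul_comm, hn, smul_zero]
  -- the quotient `g : W → W' = W/S`
  obtain ⟨W', hW', g, f, hker, -, -⟩ := exists_isogeny_ker_eq_and_comp_eq_nsmul_holds (W := W) S hSfin hSstab
  -- `#S = 2^k`
  haveI : Finite S := hSfin.to_subtype
  have hS2 : ∃ k : ℕ, Nat.card S = 2 ^ k := by
    refine natCard_eq_two_pow_of_forall_nsmul_eq_zero fun s ↦ ?_
    obtain ⟨-, n, hn⟩ := (hSmem s.1).mp s.2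
    exact ⟨n, Subtype.ext (by simpa using hn)⟩
  have hgdeg : ∃ k : ℕ, g.degree = 2 ^ k := by
    unfold Isogeny.degree
    rw [hker]
    exact hS2
  -- `φ = λ ∘ g` (AEC III.4.11; `g` separable in characteristic 0)
  have hsep : g.deg ≤ Nat.card g.toAddMonoidHom.ker := le_of_eq (Isogeny.degree_eq_deg g).symm
  have hkerle : ∀ P : W.geomPoints, g P = 0 → φ P = 0 := by
    intro P hP
    have hP' : P ∈ g.toAddMonoidHom.ker := (AddMonoidHom.mem_ker).mpr hP
    rw [hker] at hP'
    exact ((hSmem P).mp hP').1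
  obtain ⟨lam, hlam⟩ := g.exists_eq_comp_of_ker_le φ hsep hkerle
  -- `#ker λ` is odd
  have hlamodd : Odd lam.degree := by
    unfold Isogeny.degree
    refine odd_natCard_of_forall_addOrderOf_ne_two fun Q hQ ↦ ?_
    obtain ⟨P, hP⟩ := g.surjective (Q : W'.geomPoints)
    have hφP : φ P = 0 := by
      rw [hlam P, hP]
      exact (AddMonoidHom.mem_ker).mp Q.2
    have h2Q : (2 : ℕ) • (Q : W'.geomPoints) = 0 := by
      have := addOrderOf_nsmul_eq_zero Q
      rw [hQ] at this
      exact_mod_cast congrArg Subtype.val this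
    have h2P : (2 : ℕ) • P ∈ S := by
      rw [← hker, AddMonoidHom.mem_ker, map_nsmul]
      change (2 : ℕ) • g P = 0
      rw [hP]
      exact h2Q
    obtain ⟨-, n, hn⟩ := (hSmem _).mp h2P
    have hPS : P ∈ S := (hSmem P).mpr ⟨hφP, n + 1, by rw [pow_succ, mul_smul, hn]⟩
    rw [← hker] at hPS
    have hQ0 : Q = 0 := by
      apply Subtype.ext
      change (Q : W'.geomPoints) = 0
      rw [← hP]
      exact (AddMonoidHom.mem_ker).mp hPS
    rw [hQ0, addOrderOf_zero] at hQ
    exact absurd hQ (by decide)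
  -- the dual `λ̂ : W₀ → W'` with `λ ∘ λ̂ = [#ker λ]`
  haveI := hW'
  have hsep' : lam.deg ≤ Nat.card lam.toAddMonoidHom.ker := le_of_eq (Isogeny.degree_eq_deg lam).symm
  obtain ⟨ψ, -, hψ⟩ := lam.exists_dual_of_deg_le_card_ker hsep'
  have hψodd : Odd ψ.degree := by
    unfold Isogeny.degree
    refine odd_natCard_of_forall_addOrderOf_ne_two fun Q hQ ↦ ?_
    have hkill : lam.degree • (Q : W₀.geomPoints) = 0 := by
      have h := hψ (Q : W₀.geomPoints)
      have hQ0 : ψ (Q : W₀.geomPoints) = 0 := (AddMonoidHom.mem_ker).mp Q.2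
      rw [hQ0, map_zero] at h
      exact h.symm
    have hdvd : addOrderOf (Q : W₀.geomPoints) ∣ lam.degree := addOrderOf_dvd_of_nsmul_eq_zero hkill
    rw [AddSubgroup.addOrderOf_coe, hQ] at hdvd
    exact (Nat.not_even_iff_odd.mpr hlamodd) (even_iff_two_dvd.mpr hdvd)
  exact ⟨W', hW', g, ψ, hgdeg, hψodd⟩

/-- The degree (`= #ker`) of `ι ∘ χ` for the degree-one isogeny `ι = VariableChange.toIsogeny W' C` of a change of
variables equals the degree of `χ` (`ker ι = O`). [folklore] -/
theorem degree_toIsogeny_comp {W₁ W' : WeierstrassCurve ℚ} (C : VariableChange ℚ) (χ : Isogeny W₁ W') :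
    ((VariableChange.toIsogeny W' C).comp χ).degree = χ.degree := by
  unfold Isogeny.degree
  rw [Isogeny.ker_comp, VariableChange.ker_toIsogeny, AddMonoidHom.comap_bot]

/-- **Registered stub `stub_isogenyFactor` of line `nsf` v2 (crux `StarOptBNSF`, stmt-BirchSwinnertonDyer-27047),
VERBATIM.**  A ℚ-isogeny class relation `W ~ W₀` of elliptic curves factors through a GLOBALLY MINIMAL curve `V`:
an isogeny `W → V` of 2-power degree and an isogeny `W₀ → V` of ODD degree (`exists_twoPower_odd_isogeny` followed by
the isomorphism onto a global minimal model `V = C • W'`, Silverman AEC VIII.8.3 = tree `hasGlobalMinimalModel_rat_holds`,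
as the degree-one isogeny `VariableChange.toIsogeny`).
[cite: SilvermanAEC2009, Prop. III.4.12, Cor. III.4.11, Thm. III.6.1, Cor. VIII.8.3] -/
theorem stub_isogenyFactor :
    ∀ (W W₀ : WeierstrassCurve ℚ) [W.IsElliptic] [W₀.IsElliptic], WeierstrassCurve.IsIsogenous W W₀ →
      ∃ (V : WeierstrassCurve ℚ) (_ : V.IsElliptic) (_ : V.IsGloballyMinimal)
        (φ₁ : WeierstrassCurve.Isogeny W V) (ψ : WeierstrassCurve.Isogeny W₀ V),
        (∃ k : ℕ, φ₁.degree = 2 ^ k) ∧ Odd ψ.degree := by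
  intro W W₀ _ _ hiso
  obtain ⟨φ⟩ := hiso
  obtain ⟨W', hW', g, ψ, ⟨k, hk⟩, hψ⟩ := exists_twoPower_odd_isogeny φ
  haveI := hW'
  obtain ⟨C, hC⟩ := hasGlobalMinimalModel_rat_holds W'
  refine ⟨C • W', inferInstance, hC, (VariableChange.toIsogeny W' C).comp g,
    (VariableChange.toIsogeny W' C).comp ψ, ⟨k, ?_⟩, ?_⟩
  · rw [degree_toIsogeny_comp, hk]
  · rw [degree_toIsogeny_comp]
    exact hψ

end Summit.BirchSwinnertonDyer.BirchSwinnertonDyer.Theorems.EisensteinDepletionAtTwoStarOptBNSFStubIsogenyFactor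

end
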